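import Literature.AlgebraicGeometry.GroupSchemes.BirationalGroupLawTranslate
import Literature.AlgebraicGeometry.GroupSchemes.BirationalGroupLawLeftTranslate
import Literature.AlgebraicGeometry.GroupSchemes.WeilGluingStepRightChart
import Mathlib.AlgebraicGeometry.Geometrically.Irreducible
import Mathlib.AlgebraicGeometry.Morphisms.UniversallyOpen
import HarnessLib

/-!
# A witness configuration for associativity of a strict birational group law
# (Edixhoven–Romagny Def. 3.4 (3); Artin, *Néron models*, §2 Lemma 2.4)

Topic `Literature/AlgebraicGeometry/GroupSchemes`, namespace `Literature.AlgebraicGeometry.GroupSchemes`.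
KERNEL ONLY: one theorem; no definition, no named fact, no instance, no `sorry`.  Cell `hodgecm-mathlib` (D-0151),
road W (Néron capital), piece (G0b)-F3 of the maximalisation step: the «witness configuration» input `hne` of
★ `LawData.assoc_of_le` (associativity of a law from the associativity of a sub-law on a dense open needs ONE
non-empty test scheme on which the four products `ab`, `bc`, `(ab)c`, `a(bc)` of the SUB-law are defined).

For a STRICT birational group law `L` on `𝒳/S` ([EdixhovenRomagny] Def. 3.4; `𝒳 → S` universally open with
geometrically irreducible fibres, `𝒳` irreducible) and a section `s` of `𝒳 → S`, the configuration is Artin's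
«`(a s) x = a (s x)`» ([Artin1986NeronModels] §2, Lemma 2.4): on the parameter scheme `Q = A_s ×_S A′_s`
(`A_s` = domain of the right translate `a ↦ a·s`, `A′_s` = domain of the left translate `x ↦ s·x`, both open
immersions: ★ `BirationalGroupLaw.exists_rightTranslate'`, ★ `BirationalGroupLaw.isOpenImmersion_sliceLift_comp_mul`)
the open `Ω` of pairs `(a, x)` with `(a·s, x) ∈ dom` and `(a, s·x) ∈ dom` is NON-EMPTY — the two conditions are
preimages of the dense open `dom` under the open immersions `ρ_s × ι`, `ι × λ_s : Q ↪ 𝒳 ×_S 𝒳`, and `Q` is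
irreducible (open in `𝒳 ×_S 𝒳` via `ι × ι`) and non-empty (the translate domains are dense in every fibre,
★ `exists_rightTranslate'` / ★ `exists_leftTranslate`).  On `Ω` the four `dom`-valued points `(a, s)`, `(s, x)`,
`(a s, x)`, `(a, s x)` compute `a·s`, `s·x`, `(a s)·x`, `a·(s x)`.

* `BirationalGroupLaw.exists_assoc_witnesses`.

## References
* [EdixhovenRomagny] B. Edixhoven, M. Romagny, *Group schemes out of birational group laws, Néron models*,
  Panor. Synthèses 47 (2015), Def. 3.4 (3), Lemmas 3.19–3.20.
* [Artin1986NeronModels] M. Artin, *Néron models*, in *Arithmetic Geometry*, Springer 1986, §2 Lemma 2.4 p. 222.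
-/

set_option autoImplicit false

noncomputable section

open CategoryTheory CategoryTheory.Limits AlgebraicGeometry TopologicalSpace Topology MonoidalCategory
  CartesianMonoidalCategory

namespace Literature.AlgebraicGeometry.GroupSchemes

universe u

variable {S : Scheme.{u}} {𝒳 : Over S}

namespace BirationalGroupLaw

variable (L : BirationalGroupLaw 𝒳)

/-- **A witness configuration for associativity** ([EdixhovenRomagny] Def. 3.4 (3); [Artin1986NeronModels] §2
Lemma 2.4 «`(a s) x = a (s x)`»).  For a strict birational group law `L` on `𝒳/S` (`𝒳 → S` universally open with
geometrically irreducible fibres, `𝒳` irreducible) and a section `s` of `𝒳 → S`, there is a NON-EMPTY scheme `T`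
with `T`-valued points `a`, `b`, `c` of `𝒳` and four `T`-valued points of `dom` computing `ab`, `bc`, `(ab)c` and
`a(bc)` (namely `T = Ω ⊆ A_s ×_S A′_s`, `b = s`, the points `(a, s)`, `(s, x)`, `(a s, x)`, `(a, s x)`).  This is the
input `hne` of ★ `LawData.assoc_of_le`. [cite: EdixhovenRomagny, Def. 3.4 (3) and Lemmas 3.19–3.20]
[cite: Artin1986NeronModels, §2 Lemma 2.4 p. 222] -/
theorem exists_assoc_witnesses [UniversallyOpen 𝒳.hom] [GeometricallyIrreducible 𝒳.hom]
    [IrreducibleSpace 𝒳.left] (hL : L.IsStrict) (s : S ⟶ 𝒳.left) (hs : s ≫ 𝒳.hom = 𝟙 S) :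
    ∃ (T : Scheme.{u}) (_ : Nonempty T) (a b c ab bc abc abc' : T ⟶ 𝒳.left)
        (q₁ q₂ q₃ q₄ : T ⟶ (L.dom : Scheme.{u})),
      LawData.Computes 𝒳 L.dom L.mul q₁ a b ab ∧ LawData.Computes 𝒳 L.dom L.mul q₂ b c bc ∧
      LawData.Computes 𝒳 L.dom L.mul q₃ ab c abc ∧ LawData.Computes 𝒳 L.dom L.mul q₄ a bc abc' := by
  -- irreducibility of `𝒳 ×_S 𝒳` and of the fibres of `𝒳 → S`
  haveI hPirr : IrreducibleSpace ↑(𝒳 ⊗ 𝒳).left := by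
    change IrreducibleSpace ↑(pullback 𝒳.hom 𝒳.hom); infer_instance
  have hirr : ∀ t : S, IsPreirreducible (𝒳.hom.base ⁻¹' {t}) := fun t =>
    (𝒳.hom.isIrreducible_preimage 𝒳.hom.isOpenMap isIrreducible_singleton).isPreirreducible
  obtain ⟨x₁⟩ : Nonempty 𝒳.left := inferInstance
  -- STEP 1: the right translate `ρ = (· s) : A ↪ 𝒳`, `ρ = eρ ≫ mul`, `eρ` the lift of the right slice `σ`
  obtain ⟨A, eρ, ρ, heρ, hρ, hρo, hρS, -, -, -, hAd⟩ := L.exists_rightTranslate' s hs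
  obtain ⟨hAdense, -⟩ := hAd hL hirr
  let cO : 𝒳 ⟶ 𝒳 := Over.homMk (𝒳.hom ≫ s) (by rw [Category.assoc, hs, Category.comp_id])
  let σ : 𝒳.left ⟶ (𝒳 ⊗ 𝒳).left := (lift (𝟙 𝒳) cO).left
  have heρ' : eρ ≫ L.dom.ι = A.ι ≫ σ := heρ
  have hσ1 : σ ≫ (fst 𝒳 𝒳).left = 𝟙 _ := by
    change (lift (𝟙 𝒳) cO ≫ fst 𝒳 𝒳).left = _; rw [lift_fst]; rfl
  have hσ2 : σ ≫ (snd 𝒳 𝒳).left = 𝒳.hom ≫ s := by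
    change (lift (𝟙 𝒳) cO ≫ snd 𝒳 𝒳).left = _; rw [lift_snd]; rfl
  haveI hρo' : IsOpenImmersion (eρ ≫ L.mul) := by rw [← hρ]; exact hρo
  have hρS' : (eρ ≫ L.mul) ≫ 𝒳.hom = A.ι ≫ 𝒳.hom := by rw [← hρ]; exact hρS
  -- STEP 2: the left translate `lam = (s ·) : A' ↪ 𝒳`, `lam = el ≫ mul`, `el` the lift of the left slice `σℓ`
  let σℓ : 𝒳.left ⟶ (𝒳 ⊗ 𝒳).left := pullback.lift (𝒳.hom ≫ s) (𝟙 𝒳.left)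
    (by rw [Category.assoc, hs, Category.comp_id, Category.id_comp])
  have hσℓ1 : σℓ ≫ (fst 𝒳 𝒳).left = 𝒳.hom ≫ s := pullback.lift_fst _ _ _
  have hσℓ2 : σℓ ≫ (snd 𝒳 𝒳).left = 𝟙 _ := pullback.lift_snd _ _ _
  let A' : 𝒳.left.Opens := σℓ ⁻¹ᵁ L.dom
  have hrA' : Set.range (A'.ι ≫ σℓ).base ⊆ Set.range L.dom.ι.base := by
    rintro _ ⟨a, rfl⟩
    rw [Scheme.Opens.range_ι]
    change A'.ι.base a ∈ A'
    rw [← SetLike.mem_coe, ← Scheme.Opens.range_ι]; exact ⟨a, rfl⟩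
  let el : (A' : Scheme.{u}) ⟶ (L.dom : Scheme.{u}) := IsOpenImmersion.lift L.dom.ι (A'.ι ≫ σℓ) hrA'
  have hel : el ≫ L.dom.ι = A'.ι ≫ σℓ := IsOpenImmersion.lift_fac _ _ _
  haveI hlo : IsOpenImmersion (el ≫ L.mul) :=
    L.isOpenImmersion_sliceLift_comp_mul 𝒳 s hs A' el hel (fun _ h => h)
  have hlS : (el ≫ L.mul) ≫ 𝒳.hom = A'.ι ≫ 𝒳.hom := by
    rw [Category.assoc, L.mul_comp, ← Category.assoc, hel, Category.assoc, ← Over.w (snd 𝒳 𝒳),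
      ← Category.assoc σℓ, hσℓ2, Category.id_comp]
  -- a point `a₀ ∈ A` and a point `x₀ ∈ A'` in the same fibre of `𝒳 → S`
  obtain ⟨a₀, ha₀A, -⟩ := hAdense.nonempty_inter_fibre (x := 𝒳.hom.base x₁) ⟨x₁, rfl⟩
  obtain ⟨A₂, lam₂, -, -, hA₂iff, -, -, hA₂d⟩ := L.exists_leftTranslate s hs
  obtain ⟨hA₂dense, -⟩ := hA₂d hL hirr
  obtain ⟨x₀, hx₀A₂, hx₀t⟩ := hA₂dense.nonempty_inter_fibre (x := 𝒳.hom.base a₀) ⟨a₀, rfl⟩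
  have hx₀t' : 𝒳.hom.base x₀ = 𝒳.hom.base a₀ := Set.mem_singleton_iff.mp hx₀t
  have hx₀ : x₀ ∈ A' := by
    change σℓ.base x₀ ∈ L.dom
    rw [show σℓ = _ from (sectionSliceLeft_eq_pullbackLift 𝒳 s hs).symm]
    exact (hA₂iff x₀).mp hx₀A₂
  -- STEP 3: the parameter scheme `Q = A ×_S A'` with its three open immersions into `𝒳 ×_S 𝒳`
  let AO : Over S := Over.mk (A.ι ≫ 𝒳.hom)
  let ιO : AO ⟶ 𝒳 := Over.homMk A.ι rfl
  let ρO : AO ⟶ 𝒳 := Over.homMk (eρ ≫ L.mul) hρS'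
  let A'O : Over S := Over.mk (A'.ι ≫ 𝒳.hom)
  let ι'O : A'O ⟶ 𝒳 := Over.homMk A'.ι rfl
  let lamO : A'O ⟶ 𝒳 := Over.homMk (el ≫ L.mul) hlS
  haveI : IsOpenImmersion ιO.left := inferInstanceAs (IsOpenImmersion A.ι)
  haveI : IsOpenImmersion ρO.left := inferInstanceAs (IsOpenImmersion (eρ ≫ L.mul))
  haveI : IsOpenImmersion ι'O.left := inferInstanceAs (IsOpenImmersion A'.ι)
  haveI : IsOpenImmersion lamO.left := inferInstanceAs (IsOpenImmersion (el ≫ L.mul))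
  let Q : Scheme.{u} := (AO ⊗ A'O).left
  let qA : Q ⟶ (A : Scheme.{u}) := (fst AO A'O).left
  let qA' : Q ⟶ (A' : Scheme.{u}) := (snd AO A'O).left
  let θ₁ : Q ⟶ (𝒳 ⊗ 𝒳).left := (ιO ⊗ₘ ι'O).left
  let θ₂ : Q ⟶ (𝒳 ⊗ 𝒳).left := (ιO ⊗ₘ lamO).left
  let θ₃ : Q ⟶ (𝒳 ⊗ 𝒳).left := (ρO ⊗ₘ ι'O).left
  haveI : IsOpenImmersion θ₁ := isOpenImmersion_tensorHom_left' ιO ι'O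
  haveI : IsOpenImmersion θ₂ := isOpenImmersion_tensorHom_left' ιO lamO
  haveI : IsOpenImmersion θ₃ := isOpenImmersion_tensorHom_left' ρO ι'O
  have hθ₂1 : θ₂ ≫ (fst 𝒳 𝒳).left = qA ≫ A.ι := tensorHom_left_fst_left' ιO lamO
  have hθ₂2 : θ₂ ≫ (snd 𝒳 𝒳).left = qA' ≫ el ≫ L.mul := tensorHom_left_snd_left' ιO lamO
  have hθ₃1 : θ₃ ≫ (fst 𝒳 𝒳).left = qA ≫ eρ ≫ L.mul := tensorHom_left_fst_left' ρO ι'O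
  have hθ₃2 : θ₃ ≫ (snd 𝒳 𝒳).left = qA' ≫ A'.ι := tensorHom_left_snd_left' ρO ι'O
  -- `Q` is non-empty and irreducible
  have ha₀' : a₀ ∈ Set.range A.ι.base := by rw [Scheme.Opens.range_ι]; exact ha₀A
  obtain ⟨a₁, ha₁⟩ := ha₀'
  have hx₀' : x₀ ∈ Set.range A'.ι.base := by rw [Scheme.Opens.range_ι]; exact hx₀
  obtain ⟨x₂, hx₂⟩ := hx₀'
  haveI : Nonempty Q := by
    obtain ⟨z, -, -⟩ := Scheme.Pullback.exists_preimage_pullback (f := AO.hom) (g := A'O.hom) a₁ x₂ (by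
      change (A.ι ≫ 𝒳.hom).base a₁ = (A'.ι ≫ 𝒳.hom).base x₂
      simp only [Scheme.Hom.comp_base, TopCat.coe_comp, Function.comp_apply]
      rw [ha₁, hx₂]; exact hx₀t'.symm)
    exact ⟨z⟩
  haveI : IrreducibleSpace Q := θ₁.isOpenEmbedding.irreducibleSpace
  -- STEP 4: the good open `Ω ⊆ Q`: `(a s, x) ∈ dom` and `(a, s x) ∈ dom`; it is non-empty
  let Ω : Q.Opens := θ₃ ⁻¹ᵁ L.dom ⊓ θ₂ ⁻¹ᵁ L.dom
  have hdomne : ((L.dom : Set ↑(𝒳 ⊗ 𝒳).left)).Nonempty := L.dense_dom.dense.nonempty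
  have hN : ∀ (g : Q ⟶ (𝒳 ⊗ 𝒳).left) [IsOpenImmersion g],
      ((g ⁻¹ᵁ L.dom : Q.Opens) : Set Q).Nonempty := by
    intro g _
    obtain ⟨_, ⟨p, rfl⟩, hp⟩ := nonempty_preirreducible_inter g.opensRange.2 L.dom.2
      ⟨_, Classical.arbitrary Q, rfl⟩ hdomne
    exact ⟨p, hp⟩
  have hΩ : (Ω : Set Q).Nonempty :=
    nonempty_preirreducible_inter (θ₃ ⁻¹ᵁ L.dom).2 (θ₂ ⁻¹ᵁ L.dom).2 (hN θ₃) (hN θ₂)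
  haveI : Nonempty (Ω : Scheme.{u}) := by
    obtain ⟨p, hp⟩ := hΩ; exact ⟨⟨p, hp⟩⟩
  have memΩ : ∀ q : (Ω : Scheme.{u}), θ₃.base (Ω.ι.base q) ∈ L.dom ∧ θ₂.base (Ω.ι.base q) ∈ L.dom :=
    fun q => by
    have : Ω.ι.base q ∈ Ω := by rw [← SetLike.mem_coe, ← Scheme.Opens.range_ι]; exact ⟨q, rfl⟩
    exact ⟨this.1, this.2⟩
  -- STEP 5: the four witnesses `q₁ = (a, s)`, `q₂ = (s, x)`, `q₃ = (a s, x)`, `q₄ = (a, s x)`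
  have r₃ : Set.range (Ω.ι ≫ θ₃).base ⊆ Set.range L.dom.ι.base := by
    rintro _ ⟨q, rfl⟩; rw [Scheme.Opens.range_ι]; exact (memΩ q).1
  obtain ⟨q₃, hq₃⟩ : ∃ q₃ : (Ω : Scheme.{u}) ⟶ (L.dom : Scheme.{u}), q₃ ≫ L.dom.ι = Ω.ι ≫ θ₃ :=
    ⟨IsOpenImmersion.lift L.dom.ι (Ω.ι ≫ θ₃) r₃, IsOpenImmersion.lift_fac _ _ _⟩
  have r₄ : Set.range (Ω.ι ≫ θ₂).base ⊆ Set.range L.dom.ι.base := by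
    rintro _ ⟨q, rfl⟩; rw [Scheme.Opens.range_ι]; exact (memΩ q).2
  obtain ⟨q₄, hq₄⟩ : ∃ q₄ : (Ω : Scheme.{u}) ⟶ (L.dom : Scheme.{u}), q₄ ≫ L.dom.ι = Ω.ι ≫ θ₂ :=
    ⟨IsOpenImmersion.lift L.dom.ι (Ω.ι ≫ θ₂) r₄, IsOpenImmersion.lift_fac _ _ _⟩
  -- coordinate identities
  have eρ_fst : eρ ≫ L.dom.ι ≫ (fst 𝒳 𝒳).left = A.ι := by
    rw [← Category.assoc, heρ', Category.assoc, hσ1, Category.comp_id]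
  have eρ_snd : eρ ≫ L.dom.ι ≫ (snd 𝒳 𝒳).left = A.ι ≫ 𝒳.hom ≫ s := by
    rw [← Category.assoc, heρ', Category.assoc, hσ2]
  have el_fst : el ≫ L.dom.ι ≫ (fst 𝒳 𝒳).left = A'.ι ≫ 𝒳.hom ≫ s := by
    rw [← Category.assoc, hel, Category.assoc, hσℓ1]
  have el_snd : el ≫ L.dom.ι ≫ (snd 𝒳 𝒳).left = A'.ι := by
    rw [← Category.assoc, hel, Category.assoc, hσℓ2, Category.comp_id]
  have hQS : qA ≫ A.ι ≫ 𝒳.hom = qA' ≫ A'.ι ≫ 𝒳.hom := by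
    change (fst AO A'O).left ≫ AO.hom = (snd AO A'O).left ≫ A'O.hom
    rw [Over.w, Over.w]
  have q₃_fst : q₃ ≫ L.dom.ι ≫ (fst 𝒳 𝒳).left = Ω.ι ≫ qA ≫ eρ ≫ L.mul := by
    rw [← Category.assoc, hq₃, Category.assoc, hθ₃1]
  have q₃_snd : q₃ ≫ L.dom.ι ≫ (snd 𝒳 𝒳).left = Ω.ι ≫ qA' ≫ A'.ι := by
    rw [← Category.assoc, hq₃, Category.assoc, hθ₃2]
  have q₄_fst : q₄ ≫ L.dom.ι ≫ (fst 𝒳 𝒳).left = Ω.ι ≫ qA ≫ A.ι := by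
    rw [← Category.assoc, hq₄, Category.assoc, hθ₂1]
  have q₄_snd : q₄ ≫ L.dom.ι ≫ (snd 𝒳 𝒳).left = Ω.ι ≫ qA' ≫ el ≫ L.mul := by
    rw [← Category.assoc, hq₄, Category.assoc, hθ₂2]
  -- the four computations `a·s`, `s·x`, `(a s)·x`, `a·(s x)` on `Ω`
  have c₁ : LawData.Computes 𝒳 L.dom L.mul (Ω.ι ≫ qA ≫ eρ) (Ω.ι ≫ qA ≫ A.ι) (Ω.ι ≫ qA ≫ A.ι ≫ 𝒳.hom ≫ s)
      ((Ω.ι ≫ qA ≫ eρ) ≫ L.mul) :=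
    ⟨by simp only [Category.assoc, eρ_fst], by simp only [Category.assoc, eρ_snd], rfl⟩
  have c₂ : LawData.Computes 𝒳 L.dom L.mul (Ω.ι ≫ qA' ≫ el) (Ω.ι ≫ qA ≫ A.ι ≫ 𝒳.hom ≫ s)
      (Ω.ι ≫ qA' ≫ A'.ι) ((Ω.ι ≫ qA' ≫ el) ≫ L.mul) :=
    ⟨by simp only [Category.assoc, el_fst]; rw [← reassoc_of% hQS],
      by simp only [Category.assoc, el_snd], rfl⟩
  have c₃ : LawData.Computes 𝒳 L.dom L.mul q₃ ((Ω.ι ≫ qA ≫ eρ) ≫ L.mul) (Ω.ι ≫ qA' ≫ A'.ι)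
      (q₃ ≫ L.mul) :=
    ⟨by rw [q₃_fst]; simp only [Category.assoc], q₃_snd, rfl⟩
  have c₄ : LawData.Computes 𝒳 L.dom L.mul q₄ (Ω.ι ≫ qA ≫ A.ι) ((Ω.ι ≫ qA' ≫ el) ≫ L.mul)
      (q₄ ≫ L.mul) :=
    ⟨q₄_fst, by rw [q₄_snd]; simp only [Category.assoc], rfl⟩
  exact ⟨(Ω : Scheme.{u}), inferInstance, _, _, _, _, _, _, _, _, _, q₃, q₄, c₁, c₂, c₃, c₄⟩

end BirationalGroupLaw

end Literature.AlgebraicGeometry.GroupSchemes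

end
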